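import Mathlib
import Summits.PneNP.PneNP.Theorems.PstarUniformRepeats

/-!
# Uniform typed `P⋆` instances are linearisable above `m = 3·n^{3/2}` (ROUND-23 item T23.4)

FRONTIER range-avoidance ladder, ROUND-23 item T23.4 (cell `pnp-ideate`, planner seat p3's seed §5; restricted-model
combinatorics — nothing here bears on `P` versus `NP`).

**Theorem** (`card_nonLin_mul_le`).  In the tree's random typed `P⋆` model `PstarExpandingModel.Outcome N m` on
`n = N + N` variables (ordered XOR pair on the left copy, ordered AND pair of distinct variables on the right copy, all
`(N² − N)²` choices per output), for `N ≥ 40` and `m² ≥ 9·n³` (i.e. `m ≥ 3·n^{3/2}`) all but an `N/m = n/(2m) ≤ 1/(6√n)`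
fraction of the outcomes `ω` have `n + numAndPairs (inst ω) < m`, i.e. lie in the LINEARISABLE class
`PstarLinearisation.LinearisablePstar` — which ONE polynomial-time function solves at every stretch
(`PstarLinearisation.pstarLinearisable_localAvoidLinearFP`, rung R20-lin).  So the uniform model needs no refutation
machinery above the `n^{3/2}` threshold of [GuruswamiLyuYuan2025]: collisions of AND pairs alone make the output
polynomials linearly dependent.  (A remark on the uniform candidate; the worst-case instances with a SIMPLE AND graph at the
same density are untouched — ROUND-23 §5, §7.)

**Proof** (second moment, as plain counting; the exact moments are `PstarUniformRepeats`).  With `K = C(N,2)` bins and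
`D(ω)` distinct AND pairs: `E[D] = K(1 − (1 − 1/K)^m)`, so the mean number of repeats `m − E[D]` is at least
`C(m,2)/K − C(m,3)/K²` by the Bonferroni-type bound `(1 − x)^m ≥ 1 − mx + C(m,2)x² − C(m,3)x³` (`bonferroni_three`); the
miss events of two bins are negatively correlated, whence `Var(D) ≤ E[D] ≤ m` (`PstarUniformRepeats.variance_le`); and
Chebyshev as counting (`card_filter_mul_sq_le`).  In the window `m ≤ K + 2N` this gives
`#{not linearisable} ≤ m·W/gap²` with `gap ≥ m²/(4K)`; above the window every outcome is linearisable since `D ≤ K`.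
Honest rate: `1/√n`, not `1/n` — the cheap variance bound `Var ≤ E[D]` is used, not the true `Var ≈ m²/(2K)`.
-/

set_option linter.dupNamespace false -- `Summit.PneNP.PneNP.…`: summit = sub-problem name (D-0017 single-conjunct layout)

open Finset Literature.Computability.Complexity
open Summit.PneNP.PneNP.Theorems.PstarExpandingModel (DPair Outcome inst)
open Summit.PneNP.PneNP.Theorems.PstarLinearisation (numAndPairs LinearisablePstar)
open Summit.PneNP.PneNP.Theorems.PstarUniformRepeats

namespace Summit.PneNP.PneNP.Theorems.PstarUniformLinearisable

variable {N m : ℕ}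

/-! ## Two generic inequalities -/

/-- **Bonferroni-type lower bound**: `1 − mx + C(m,2)x² − C(m,3)x³ ≤ (1 − x)^m` for `x ≤ 1` (induction on `m`:
`(1 − x)·g_m(x) = g_{m+1}(x) + C(m,3)·x⁴`). -/
theorem bonferroni_three (x : ℝ) (hx1 : x ≤ 1) (m : ℕ) :
    1 - m * x + (m.choose 2 : ℝ) * x ^ 2 - (m.choose 3 : ℝ) * x ^ 3 ≤ (1 - x) ^ m := by
  induction m with
  | zero => simp
  | succ k ih =>
    have h1 : 0 ≤ 1 - x := sub_nonneg.2 hx1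
    have step : (1 - x) * (1 - k * x + (k.choose 2 : ℝ) * x ^ 2 - (k.choose 3 : ℝ) * x ^ 3) ≤ (1 - x) ^ (k + 1) := by
      rw [show (1 - x) ^ (k + 1) = (1 - x) * (1 - x) ^ k from pow_succ' _ _]
      exact mul_le_mul_of_nonneg_left ih h1
    have e2 : (((k + 1).choose 2 : ℕ) : ℝ) = (k.choose 2 : ℝ) + k := by
      rw [Nat.choose_succ_succ', Nat.choose_one_right]; push_cast; ring
    have e3 : (((k + 1).choose 3 : ℕ) : ℝ) = (k.choose 3 : ℝ) + (k.choose 2 : ℝ) := by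
      rw [Nat.choose_succ_succ']; push_cast; ring
    rw [e2, e3]
    push_cast
    have hx4 : 0 ≤ (k.choose 3 : ℝ) * x ^ 4 := by positivity
    nlinarith [step, hx4]

/-- **Chebyshev's inequality as counting**: if `μ` is the mean of `f` on `s` and `μ ≤ τ` then
`#{i ∈ s : τ ≤ f i} · (τ − μ)² ≤ Σ f² − μ Σ f  (= Σ (f − μ)²)`. -/
theorem card_filter_mul_sq_le {ι : Type*} (s : Finset ι) (f : ι → ℝ) (μ τ : ℝ)
    (hμ : μ * s.card = ∑ i ∈ s, f i) (hτ : μ ≤ τ) :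
    ((s.filter fun i => τ ≤ f i).card : ℝ) * (τ - μ) ^ 2 ≤ ∑ i ∈ s, f i ^ 2 - μ * ∑ i ∈ s, f i := by
  have h1 : ((s.filter fun i => τ ≤ f i).card : ℝ) * (τ - μ) ^ 2 =
      ∑ i ∈ s.filter (fun i => τ ≤ f i), (τ - μ) ^ 2 := by
    rw [sum_const, nsmul_eq_mul]
  have h2 : ∑ i ∈ s.filter (fun i => τ ≤ f i), (τ - μ) ^ 2 ≤ ∑ i ∈ s.filter (fun i => τ ≤ f i), (f i - μ) ^ 2 := by
    refine sum_le_sum fun i hi => ?_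
    rw [mem_filter] at hi
    have h0 : 0 ≤ τ - μ := sub_nonneg.2 hτ
    exact pow_le_pow_left₀ h0 (by linarith [hi.2]) 2
  have h3 : ∑ i ∈ s.filter (fun i => τ ≤ f i), (f i - μ) ^ 2 ≤ ∑ i ∈ s, (f i - μ) ^ 2 :=
    sum_le_sum_of_subset_of_nonneg (filter_subset _ _) (fun i _ _ => sq_nonneg _)
  have h4 : ∑ i ∈ s, (f i - μ) ^ 2 = ∑ i ∈ s, f i ^ 2 - μ * ∑ i ∈ s, f i := by
    have e : ∀ i ∈ s, (f i - μ) ^ 2 = f i ^ 2 - 2 * μ * f i + μ ^ 2 := fun i _ => by ring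
    rw [sum_congr rfl e, sum_add_distrib, sum_sub_distrib, sum_const, nsmul_eq_mul, ← mul_sum]
    have : (s.card : ℝ) * μ ^ 2 = μ * ∑ i ∈ s, f i := by rw [← hμ]; ring
    linarith
  linarith

/-! ## The model constants in real form -/

/-- `2·C(N,2) = N(N−1)` in `ℝ`. -/
theorem two_mul_choose_two (N : ℕ) : (2 : ℝ) * (N.choose 2 : ℝ) = (N : ℝ) * ((N : ℝ) - 1) := by
  rw [Nat.cast_choose_two]; ring

/-- `K₀ = N(N−1) = 2·C(N,2)` in `ℝ`. -/
theorem K0_real (N : ℕ) : (K0 N : ℝ) = 2 * (N.choose 2 : ℝ) := by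
  rw [two_mul_choose_two, K0, card_DPair, Nat.cast_sub (Nat.le_mul_self N)]
  push_cast; ring

/-- `M₁ / W = (1 − 1/K)^m` with `K = C(N,2)`, for `N ≥ 2`. -/
theorem missOne_div (hN : 2 ≤ N) (m : ℕ) :
    (missOne N m : ℝ) / (Fintype.card (Outcome N m) : ℝ) = (1 - 1 / (N.choose 2 : ℝ)) ^ m := by
  have hK0 : 2 ≤ K0 N := by
    rw [K0, card_DPair]
    have : N + 2 ≤ N * N := by nlinarith
    omega
  have hKpos : (0 : ℝ) < (N.choose 2 : ℝ) := by
    have := K0_real N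
    have h2 : (2 : ℝ) ≤ (K0 N : ℝ) := by exact_mod_cast hK0
    linarith
  rw [card_Outcome_eq, missOne]
  push_cast [Nat.cast_sub hK0]
  rw [← div_pow]
  congr 1
  rw [K0_real]
  field_simp

/-! ## The mean number of repeats -/

/-- **Mean of `D`**: `S₁/W ≤ m − C(m,2)/K + C(m,3)/K²` (`K = C(N,2)`, `N ≥ 2`). -/
theorem mean_le (hN : 2 ≤ N) (m : ℕ) :
    ((∑ ω : Outcome N m, dval ω : ℕ) : ℝ) / (Fintype.card (Outcome N m) : ℝ) ≤
      m - (m.choose 2 : ℝ) / (N.choose 2 : ℝ) + (m.choose 3 : ℝ) / (N.choose 2 : ℝ) ^ 2 := by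
  have hW : (0 : ℝ) < (Fintype.card (Outcome N m) : ℝ) := by exact_mod_cast card_Outcome_pos (m := m) hN
  have hK0 : 2 ≤ K0 N := by
    rw [K0, card_DPair]
    have : N + 2 ≤ N * N := by nlinarith
    omega
  have hKpos : (0 : ℝ) < (N.choose 2 : ℝ) := by
    have := K0_real N
    have h2 : (2 : ℝ) ≤ (K0 N : ℝ) := by exact_mod_cast hK0
    linarith
  set K : ℝ := (N.choose 2 : ℝ) with hKdef
  have hq := missOne_div hN m
  rw [sum_dval_real, mul_sub, sub_div, mul_div_assoc, mul_div_assoc, div_self hW.ne', hq, mul_one]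
  -- Bonferroni at `x = 1/K`
  have hx1 : 1 / K ≤ 1 := by
    rw [div_le_one hKpos]
    have h2 : (2 : ℝ) ≤ (K0 N : ℝ) := by exact_mod_cast hK0
    rw [K0_real] at h2
    linarith
  have hb := bonferroni_three (1 / K) hx1 m
  have e : K * (1 - m * (1 / K) + (m.choose 2 : ℝ) * (1 / K) ^ 2 - (m.choose 3 : ℝ) * (1 / K) ^ 3) =
      K - m + (m.choose 2 : ℝ) / K - (m.choose 3 : ℝ) / K ^ 2 := by
    field_simp
  have := mul_le_mul_of_nonneg_left hb hKpos.le
  rw [e] at this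
  linarith

/-! ## The non-linearisable outcomes -/

/-- The outcomes whose instance is NOT in the linearisable class. -/
noncomputable def nonLin (N m : ℕ) : Finset (Outcome N m) := by
  classical exact univ.filter fun ω => ¬LinearisablePstar (inst ω)

/-- The non-linearisable outcomes are those with `m − 2N ≤ D(ω)`. -/
theorem nonLin_eq (N m : ℕ) :
    nonLin N m = univ.filter fun ω : Outcome N m => (m : ℝ) - 2 * N ≤ (dval ω : ℝ) := by
  classical
  unfold nonLin
  refine filter_congr (fun ω _ => ?_)
  rw [not_linearisable_iff]
  constructor
  · intro h
    have h' : (m : ℝ) ≤ (N : ℝ) + N + dval ω := by exact_mod_cast h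
    linarith
  · intro h
    have h' : (m : ℝ) ≤ ((N + N + dval ω : ℕ) : ℝ) := by push_cast; linarith
    exact_mod_cast h'

/-- Above the window every outcome is linearisable: `D ≤ C(N,2)`. -/
theorem nonLin_eq_empty (h : N.choose 2 + 2 * N < m) : nonLin N m = ∅ := by
  classical
  unfold nonLin
  refine filter_eq_empty_iff.2 (fun ω _ => ?_)
  rw [not_linearisable_iff, not_le]
  have := dval_le_choose ω
  omega

/-- **Chebyshev in the window.**  For `N ≥ 3` and any threshold gap `g > 0` below the true gap,
`#nonLin · g² ≤ m · W`. -/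
theorem card_nonLin_mul_sq_le (hN : 3 ≤ N) (g : ℝ) (hg : 0 < g)
    (hgap : g ≤ (m : ℝ) - 2 * N - ((∑ ω : Outcome N m, dval ω : ℕ) : ℝ) / (Fintype.card (Outcome N m) : ℝ)) :
    ((nonLin N m).card : ℝ) * g ^ 2 ≤ (m : ℝ) * (Fintype.card (Outcome N m) : ℝ) := by
  have hW : (0 : ℝ) < (Fintype.card (Outcome N m) : ℝ) := by
    exact_mod_cast card_Outcome_pos (m := m) (by omega : 2 ≤ N)
  set W : ℝ := (Fintype.card (Outcome N m) : ℝ) with hWdef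
  set S1 : ℝ := ((∑ ω : Outcome N m, dval ω : ℕ) : ℝ) with hS1def
  set μ : ℝ := S1 / W with hμdef
  set τ : ℝ := (m : ℝ) - 2 * N with hτdef
  have hμW : μ * (univ : Finset (Outcome N m)).card = ∑ ω : Outcome N m, (dval ω : ℝ) := by
    rw [card_univ, hμdef, hS1def, Nat.cast_sum, ← hWdef, div_mul_cancel₀ _ hW.ne']
  have hτμ : μ ≤ τ := by linarith
  have hcheb := card_filter_mul_sq_le (univ : Finset (Outcome N m)) (fun ω => (dval ω : ℝ)) μ τ hμW hτμ
  rw [← nonLin_eq] at hcheb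
  -- the right-hand side is `S₂ − S₁²/W ≤ S₁ ≤ m W`
  have hS2 : ∑ ω : Outcome N m, ((dval ω : ℝ)) ^ 2 = ((∑ ω : Outcome N m, dval ω ^ 2 : ℕ) : ℝ) := by push_cast; rfl
  have hS1 : ∑ ω : Outcome N m, (dval ω : ℝ) = S1 := by rw [hS1def, Nat.cast_sum]
  rw [hS2, hS1] at hcheb
  have hvar := variance_le (m := m) hN
  rw [← hS1def, ← hWdef] at hvar
  have hμS : μ * S1 = S1 ^ 2 / W := by rw [hμdef]; ring
  have hS1m : S1 ≤ (m : ℝ) * W := by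
    have h := Finset.sum_le_card_nsmul (univ : Finset (Outcome N m)) (fun ω => dval ω) m (fun ω _ => dval_le ω)
    rw [card_univ, smul_eq_mul] at h
    have h' : ((∑ ω : Outcome N m, dval ω : ℕ) : ℝ) ≤ ((Fintype.card (Outcome N m) * m : ℕ) : ℝ) := by
      exact_mod_cast h
    push_cast at h'
    rw [hS1def, hWdef]
    linarith
  -- monotonicity in the gap
  have hmono : ((nonLin N m).card : ℝ) * g ^ 2 ≤ ((nonLin N m).card : ℝ) * (τ - μ) ^ 2 := by
    refine mul_le_mul_of_nonneg_left ?_ (Nat.cast_nonneg _)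
    exact pow_le_pow_left₀ hg.le (by rw [hτdef, hμdef]; exact hgap) 2
  linarith

/-- **The gap in the window**: for `N ≥ 40`, `72N³ ≤ m²` and `m ≤ C(N,2) + 2N`,
`m²/(4K) ≤ C(m,2)/K − C(m,3)/K² − 2N` with `K = C(N,2)`. -/
theorem gap_ge (hN : 40 ≤ N) (hm : 72 * N ^ 3 ≤ m ^ 2) (hmK : m ≤ N.choose 2 + 2 * N) :
    (m : ℝ) ^ 2 / (4 * (N.choose 2 : ℝ)) ≤
      (m.choose 2 : ℝ) / (N.choose 2 : ℝ) - (m.choose 3 : ℝ) / (N.choose 2 : ℝ) ^ 2 - 2 * N := by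
  set K : ℝ := (N.choose 2 : ℝ) with hKdef
  have hK2 : 2 * K = (N : ℝ) * ((N : ℝ) - 1) := two_mul_choose_two N
  have hNr : (40 : ℝ) ≤ N := by exact_mod_cast hN
  have hKpos : 0 < K := by nlinarith
  have hmr : (72 : ℝ) * (N : ℝ) ^ 3 ≤ (m : ℝ) ^ 2 := by exact_mod_cast hm
  have hmKr : (m : ℝ) ≤ K + 2 * N := by rw [hKdef]; exact_mod_cast hmK
  have hm10 : (10 : ℝ) ≤ m := by nlinarith
  have hm2 : 2 ≤ m := by
    have : (2 : ℝ) ≤ m := by linarith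
    exact_mod_cast this
  -- closed forms of the binomials
  have hc2 : (m.choose 2 : ℝ) = (m : ℝ) * ((m : ℝ) - 1) / 2 := Nat.cast_choose_two ℝ m
  have hc3 : (m.choose 3 : ℝ) * 3 = (m.choose 2 : ℝ) * ((m : ℝ) - 2) := by
    have h := Nat.choose_succ_right_eq m 2
    have h' : ((m.choose 3 * 3 : ℕ) : ℝ) = ((m.choose 2 * (m - 2) : ℕ) : ℝ) := by rw [h]
    push_cast [Nat.cast_sub hm2] at h'
    linarith
  -- step 1: `K − (m − 2)/3 ≥ (5/8)·K`
  have hstep1 : (5 / 8 : ℝ) * K ≤ K - ((m : ℝ) - 2) / 3 := by nlinarith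
  -- step 2: `C(m,2) ≥ (9/20)·m²`
  have hstep2 : (9 / 20 : ℝ) * (m : ℝ) ^ 2 ≤ (m.choose 2 : ℝ) := by rw [hc2]; nlinarith
  -- step 3: `2N·K² ≤ m²·K/72`
  have hKle : K ≤ (N : ℝ) ^ 2 / 2 := by nlinarith
  have hstep3 : 2 * (N : ℝ) * K ^ 2 ≤ (m : ℝ) ^ 2 * K / 72 := by
    have h1 : (N : ℝ) * K ≤ (N : ℝ) ^ 3 / 2 := by nlinarith
    nlinarith
  -- assemble: `gap·K² ≥ m²·K/4`
  have hc2nn : (0 : ℝ) ≤ (m.choose 2 : ℝ) := Nat.cast_nonneg _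
  have hmain : (m : ℝ) ^ 2 * K / 4 ≤
      ((m.choose 2 : ℝ) / K - (m.choose 3 : ℝ) / K ^ 2 - 2 * N) * K ^ 2 := by
    have e : ((m.choose 2 : ℝ) / K - (m.choose 3 : ℝ) / K ^ 2 - 2 * N) * K ^ 2 =
        (m.choose 2 : ℝ) * (K - ((m : ℝ) - 2) / 3) - 2 * N * K ^ 2 := by
      have e3 : (m.choose 3 : ℝ) = (m.choose 2 : ℝ) * ((m : ℝ) - 2) / 3 := by linarith
      rw [e3]; field_simp
    rw [e]
    have h13 : (9 / 20 : ℝ) * (m : ℝ) ^ 2 * ((5 / 8 : ℝ) * K) ≤ (m.choose 2 : ℝ) * (K - ((m : ℝ) - 2) / 3) :=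
      mul_le_mul hstep2 hstep1 (by positivity) hc2nn
    nlinarith
  rw [div_le_iff₀ (by positivity)]
  have h' : (m : ℝ) ^ 2 * K ≤
      ((m.choose 2 : ℝ) / K - (m.choose 3 : ℝ) / K ^ 2 - 2 * N) * (4 * K) * K := by nlinarith [hmain]
  exact le_of_mul_le_mul_right h' hKpos

/-- **T23.4 — uniform typed `P⋆` instances above `m = 3·n^{3/2}` are linearisable, all but an `N/m`-fraction.**
For `N ≥ 40` and `9·(N+N)³ ≤ m²`:  `#{ω : ¬ LinearisablePstar (inst ω)} · m ≤ N · #Outcome N m`. -/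
theorem card_nonLin_mul_le (N m : ℕ) (hN : 40 ≤ N) (hm : 9 * (N + N) ^ 3 ≤ m ^ 2) :
    (nonLin N m).card * m ≤ N * Fintype.card (Outcome N m) := by
  have hm' : 72 * N ^ 3 ≤ m ^ 2 := by
    have : 9 * (N + N) ^ 3 = 72 * N ^ 3 := by ring
    omega
  rcases le_or_gt m (N.choose 2 + 2 * N) with hmK | hmK
  · -- the window: Chebyshev
    set K : ℝ := (N.choose 2 : ℝ) with hKdef
    have hK2 : 2 * K = (N : ℝ) * ((N : ℝ) - 1) := two_mul_choose_two N
    have hNr : (40 : ℝ) ≤ N := by exact_mod_cast hN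
    have hKpos : 0 < K := by nlinarith
    have hmr : (72 : ℝ) * (N : ℝ) ^ 3 ≤ (m : ℝ) ^ 2 := by exact_mod_cast hm'
    set g : ℝ := (m : ℝ) ^ 2 / (4 * K) with hgdef
    have hgpos : 0 < g := by
      rw [hgdef]
      have : (0 : ℝ) < (m : ℝ) ^ 2 := by nlinarith
      positivity
    have hgap := gap_ge hN hm' hmK
    have hmean := mean_le (m := m) (by omega : 2 ≤ N)
    have hcheb := card_nonLin_mul_sq_le (m := m) (by omega : 3 ≤ N) g hgpos (by rw [hgdef]; linarith)
    -- `N·g² ≥ m²`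
    have hKle : K ≤ (N : ℝ) ^ 2 / 2 := by nlinarith
    have hNg : (m : ℝ) ^ 2 ≤ (N : ℝ) * g ^ 2 := by
      rw [hgdef, div_pow, mul_div_assoc']
      rw [le_div_iff₀ (by positivity)]
      have h16 : (4 * K) ^ 2 ≤ 4 * (N : ℝ) ^ 4 := by nlinarith
      have hm4 : (m : ℝ) ^ 2 * (4 * K) ^ 2 ≤ (m : ℝ) ^ 2 * (4 * (N : ℝ) ^ 4) :=
        mul_le_mul_of_nonneg_left h16 (sq_nonneg _)
      have h4 : 4 * (N : ℝ) ^ 3 ≤ (m : ℝ) ^ 2 := by nlinarith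
      have h5 := mul_le_mul_of_nonneg_left h4 (mul_nonneg (Nat.cast_nonneg N : (0 : ℝ) ≤ N) (sq_nonneg (m : ℝ)))
      have : (m : ℝ) ^ 2 * (4 * (N : ℝ) ^ 4) ≤ (N : ℝ) * ((m : ℝ) ^ 2) ^ 2 := by nlinarith [h5]
      linarith
    -- conclude in `ℝ`
    have hW : (0 : ℝ) ≤ (Fintype.card (Outcome N m) : ℝ) := Nat.cast_nonneg _
    have hfin : ((nonLin N m).card : ℝ) * m ≤ (N : ℝ) * (Fintype.card (Outcome N m) : ℝ) := by
      -- `#bad·m·g² ≤ m²·W ≤ N g² W`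
      have h1 : ((nonLin N m).card : ℝ) * m * g ^ 2 ≤ (m : ℝ) ^ 2 * (Fintype.card (Outcome N m) : ℝ) := by
        have hm0 : (0 : ℝ) ≤ m := Nat.cast_nonneg _
        nlinarith [hcheb]
      have h2 : (m : ℝ) ^ 2 * (Fintype.card (Outcome N m) : ℝ) ≤
          (N : ℝ) * g ^ 2 * (Fintype.card (Outcome N m) : ℝ) := mul_le_mul_of_nonneg_right hNg hW
      have h3 : ((nonLin N m).card : ℝ) * m * g ^ 2 ≤ ((N : ℝ) * (Fintype.card (Outcome N m) : ℝ)) * g ^ 2 := by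
        linarith
      exact le_of_mul_le_mul_right h3 (by positivity)
    exact_mod_cast hfin
  · -- above the window: nothing is bad
    rw [nonLin_eq_empty hmK, card_empty, Nat.zero_mul]
    exact Nat.zero_le _

/-- **T23.4, stated with the class.**  For `N ≥ 40` and `m ≥ 3·(N+N)^{3/2}` the outcomes whose instance is OUTSIDE the
class `LinearisablePstar` — solved in FP at every stretch by `PstarLinearisation.pstarLinearisable_localAvoidLinearFP` —
are at most an `N/m ≤ 1/(6·√(N+N))` fraction of all outcomes. -/
theorem uniformLinearisable_whp (N m : ℕ) (hN : 40 ≤ N) (hm : 9 * (N + N) ^ 3 ≤ m ^ 2) :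
    ((nonLin N m).card : ℝ) ≤ (N : ℝ) / m * (Fintype.card (Outcome N m) : ℝ) := by
  have h := card_nonLin_mul_le N m hN hm
  have hmpos : (0 : ℝ) < m := by
    have hN3 : 0 < 9 * (N + N) ^ 3 := by positivity
    have : 0 < m ^ 2 := lt_of_lt_of_le hN3 hm
    exact_mod_cast Nat.pos_of_ne_zero (by rintro rfl; simp at this)
  have h' : ((nonLin N m).card : ℝ) * m ≤ (N : ℝ) * (Fintype.card (Outcome N m) : ℝ) := by exact_mod_cast h
  rw [div_mul_eq_mul_div, le_div_iff₀ hmpos]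
  linarith

end Summit.PneNP.PneNP.Theorems.PstarUniformLinearisable
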